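import Literature.AlgebraicGeometry.Frobenioids.Thm42DivIdentityPreserved
import Literature.AlgebraicGeometry.Frobenioids.PrimesEquivalence
import Literature.AlgebraicGeometry.Frobenioids.IsotropicFrobeniusTrivial
import HarnessLib

/-!
# [FrdI] Theorem 4.2 (i): the category-theoretic characterisation of Div-identity endomorphisms
# (S5 row T42-L11, slot `FrdI.T42.DivIdentityEndoCharacterisation`) — PROVED

Mochizuki, *The geometry of Frobenioids I: the general theory*, Kyushu J. Math. **62** (2008)
293–400, §4, Theorem 4.2 (i), proof p. 81 ll. 5–31 [cite: MochizukiFrdI2008, Thm. 4.2 (i) p.81]: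

> "since the `Φ_i` are non-dilating, it follows that if `A ∈ Ob(C_i)`, then `α ∈ End_{C_i}(A)` is a
> Div-identity endomorphism if and only if `α` admits a factorization `α = β ∘ γ`, where `β : B → A`
> is a pull-back morphism, and `γ : A → B` is a base-isomorphism, such that for every primary step
> `A′ → A`, there exists a commutative diagram [`A′ → A` / `γ′`, `γ` / `B′ → B` / `β′`, `β` / `A″ → A`]
> in which the horizontal morphisms are primary steps; … the equivalence classes of the primary steps
> `A′ → A`, `B′ → B` correspond via `Prime(Φ_i(γ))`; `β′` is a pull-back morphism [cf. Proposition
> 1.11, (v)]; the primary steps `A′ → A`, `A″ → A` determine the same element of `Prime(Φ_i(A))`."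

PROOF-ONLY file (abc-iut cell, F wave seat f-050, FACT-LIST row F-2654; statements file `Thm42SubII.lean`,
seat abc-iut-L1-t14): `FrdI.T42.divIdentityEndoCharacterisation_holds : DivIdentityEndoCharacterisation`, the
typed slot AS STATED (Frobenioid of perfect and isotropic type, `Φ` perf-factorial and non-dilating, `A`
non-group-like; perfect type and perf-factoriality are not used). The two directions:

* (⇐) `isDivIdentity_of_diagrams`: from the lower squares `η ≫ β = β′ ≫ ε″` (pull-backs `β, β′`, primary
  steps `η, ε″`) the divisor calculus of Prop. 1.11 (v) (`PreFrobenioid.invDiv_eq_pull_of_pullback_square`,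
  seat abc-iut-w4-d068) gives `x_η = Φ(Base β)(x_{ε″})`, so `Φ(Base α)(x_{ε″}) = Φ(Base γ)(x_η)` lies in the
  prime of `x_ε = ` the prime of `x_{ε″}`; every prime of `Φ(A)` carries a primary step into `A`
  (Def. 1.3 (iii)(d)), so `Base(α)^*` moves one element of each prime within its prime and non-dilation
  concludes (`PreFrobenioid.isDivIdentity_of_exists_precsim`);
* (⇒) `exists_diagrams_of_isDivIdentity`: `α = γ ≫ δ` with `γ` = Frobenius-type `≫` pre-step a
  base-isomorphism and `δ` a pull-back morphism (Def. 1.3 (iv)(a)); for a primary step `ε : A′ → A` the LOWER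
  square is Prop. 1.11 (v) (`PreFrobenioid.exists_preStep_pullback_square`, with `A″ := A′`, `ε″ := ε`),
  whose top arrow `η` has `x_η = Φ(Base δ)(x_ε)`, hence `Φ(Base γ)(x_η) = Φ(Base α)(x_ε) = x_ε` — so `η` is
  a primary step corresponding to `ε` under `Prime(Φ(γ))`; the UPPER square: the base-isomorphism
  `ε ≫ γ` factors as Frobenius-type `≫` co-angular pre-step `s` (Def. 1.3 (iv)(a)), `x_s = x_{ε ≫ γ}` is
  divisible by `x_η` (apply the isomorphism `Base(ε ≫ γ)^*`: `Div(ε) ∣ Div(ε ≫ γ)`, Remark 1.1.1), so `s`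
  factors through `η` (Def. 1.3 (iii)(d)).
Composition diagrammatic; monoids multiplicative. No new definitions; nothing of the paper is strengthened;
nothing here bears on [IUTchIII] Cor. 3.12.
-/

namespace Literature.AlgebraicGeometry.Frobenioids

open CategoryTheory Opposite

namespace PreFrobenioid

universe w v v' u u'

variable {D : Type u} [Category.{v} D] {Φ : Dᵒᵖ ⥤ CommMonCat.{w}}
  {C : Type u'} [Category.{v'} C] {F : C ⥤ ElemFrobenioid Φ}

/-! ### Small tools -/

/-- `x_γ = 0` for a morphism of Frobenius type `γ` (isometric). [cite: MochizukiFrdI2008, Def. 1.2 (iii) p.23] -/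
theorem invDiv_eq_one_of_isFrobeniusType {A B : C} {γ : A ⟶ B} (hγ : IsFrobeniusType F γ) :
    invDiv F γ hγ.2 = 1 := by
  unfold invDiv
  rw [show Div F γ = 1 from hγ.1.2, map_one]

/-- **A base-isomorphism is (Frobenius type) `≫` (co-angular pre-step)** in a Frobenioid of isotropic type
(Def. 1.3 (iv)(a): the pull-back factor of a base-isomorphism is an isomorphism, Remark 1.2.1).
[cite: MochizukiFrdI2008, Def. 1.3 (iv) p.25] -/
theorem exists_frobeniusType_comp_coAngularPreStep (hF : IsFrobenioid F) (hiso : IsOfIsotropicType F)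
    {A B : C} (φ : A ⟶ B) (hφ : IsBaseIso F φ) :
    ∃ (X : C) (γ : A ⟶ X) (s : X ⟶ B), γ ≫ s = φ ∧ IsFrobeniusType F γ ∧ IsCoAngularPreStep F s := by
  obtain ⟨X, Y, γ, β, α, hfac, hγ, hβ, hα⟩ := hF.iv_a_exists φ
  haveI : IsIso (Base F γ) := hγ.2
  haveI : IsIso (Base F β) := hβ.2
  haveI : IsIso (Base F φ) := hφ
  haveI : IsIso (Base F (γ ≫ β) ≫ Base F α) := by
    rw [← base_comp, Category.assoc, hfac]; infer_instance
  haveI : IsIso (Base F (γ ≫ β)) := by rw [base_comp]; infer_instance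
  have hαb : IsBaseIso F α := IsIso.of_isIso_comp_left (Base F (γ ≫ β)) (Base F α)
  haveI : IsIso α := (isPullbackMorphism_and_isBaseIso_iff_isIso F α).1 ⟨hα, hαb⟩
  have hs : IsPreStep F (β ≫ α) := IsPreStep.comp F hβ (isPreStep_of_isIso F α)
  exact ⟨X, γ, β ≫ α, hfac, hγ, isCoAngular_of_isOfIsotropicType F hiso _, hs⟩

/-! ### (⇐): from the diagrams to `Base(α)^* = id` -/

/-- **(⇐) of the characterisation**: if `α = γ ≫ β` (`β` a pull-back morphism) admits, for every primary
step `ε : A′ → A`, a diagram as in the statement, then `Base(α)^*` moves one element of each prime of `Φ(A)`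
within its prime, so `α` is a Div-identity endomorphism (`Φ` non-dilating).
[cite: MochizukiFrdI2008, Thm. 4.2 (i) p.81] -/
theorem isDivIdentity_of_diagrams (hF : IsFrobenioid F) (hnd : IsNonDilatingOn Φ) {A B : C}
    (α : A ⟶ A) (γ : A ⟶ B) (β : B ⟶ A) (hfac : γ ≫ β = α) (hβ : IsPullbackMorphism F β)
    (hdiag : ∀ ⦃A' : C⦄ (ε : A' ⟶ A), IsStep F ε → IsPrimaryPreStep F ε →
      ∃ (B' A'' : C) (_ : A' ⟶ B') (η : B' ⟶ B) (β' : B' ⟶ A'') (ε'' : A'' ⟶ A),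
        η ≫ β = β' ≫ ε'' ∧ IsPrimaryPreStep F η ∧ IsPrimaryPreStep F ε'' ∧ IsPullbackMorphism F β' ∧
        (∀ (hε : IsBaseIso F ε) (hη : IsBaseIso F η), ∃ 𝔭 : Primes (Φ.obj (op (baseObj F A))),
            invDiv F ε hε ∈ 𝔭.carrier ∧ pull Φ (Base F γ) (invDiv F η hη) ∈ 𝔭.carrier) ∧
        ∀ (hε : IsBaseIso F ε) (hε'' : IsBaseIso F ε''), ∃ 𝔭 : Primes (Φ.obj (op (baseObj F A))),
            invDiv F ε hε ∈ 𝔭.carrier ∧ invDiv F ε'' hε'' ∈ 𝔭.carrier) :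
    IsDivIdentity F α := by
  refine isDivIdentity_of_exists_precsim hF.isPreFrobenioid hnd α fun 𝔭 => ?_
  -- a primary step into `A` whose `x` lies in `𝔭`
  obtain ⟨Z, ζ, hζ, hζ𝔭⟩ := exists_isPrimaryPreStep_invDiv_mem hF A 𝔭
  obtain ⟨B', A'', -, η, β', ε'', hlow, hη, hε'', hβ', hP1, hP2⟩ := hdiag ζ (hζ.isStep hF.isPreFrobenioid) hζ
  obtain ⟨𝔭₁, hζ₁, hγη⟩ := hP1 hζ.1.2 hη.1.2
  obtain ⟨𝔭₂, hζ₂, hε''₂⟩ := hP2 hζ.1.2 hε''.1.2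
  have e₁ : 𝔭₁ = 𝔭 := Primes.eq_of_mem_carrier hζ₁ hζ𝔭
  have e₂ : 𝔭₂ = 𝔭 := Primes.eq_of_mem_carrier hζ₂ hζ𝔭
  subst e₁ e₂
  -- `x_η = Φ(Base β)(x_{ε″})`, so `Φ(Base α)(x_{ε″}) = Φ(Base γ)(x_η) ∈ 𝔭`
  have hxη := invDiv_eq_pull_of_pullback_square hF hη.1 hβ hβ' hε''.1 hlow
  refine ⟨invDiv F ε'' hε''.1.2, hε''₂, Primes.precsim_of_mem_carrier _ ?_ hε''₂⟩
  rw [← hfac, base_comp, pull_comp, ← hxη]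
  exact hγη

/-! ### (⇒): the diagrams of a Div-identity endomorphism -/

/-- **(⇒) of the characterisation, the diagram at one primary step.** For a Div-identity `α = γ ≫ δ`
(`γ` a base-isomorphism, `δ` a pull-back morphism) and a primary step `ε : A′ → A` of a Frobenioid of
isotropic type: the Prop. 1.11 (v) square `η ≫ δ = β′ ≫ ε` has `Φ(Base γ)(x_η) = x_ε` (so `η` is a primary
step corresponding to `ε` under `Prime(Φ(γ))`), and `ε ≫ γ` factors through `η`.
[cite: MochizukiFrdI2008, Thm. 4.2 (i) p.81] -/
theorem exists_diagram_of_isDivIdentity (hF : IsFrobenioid F) (hiso : IsOfIsotropicType F) {A B A' : C}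
    {α : A ⟶ A} (hα : IsDivIdentity F α) {γ : A ⟶ B} {δ : B ⟶ A} (hfac : γ ≫ δ = α) (hγ : IsBaseIso F γ)
    (hδ : IsPullbackMorphism F δ) (ε : A' ⟶ A) (hε : IsPrimaryPreStep F ε) :
    ∃ (W : C) (γ' : A' ⟶ W) (η : W ⟶ B) (β' : W ⟶ A') (hη : IsPrimaryPreStep F η),
      ε ≫ γ = γ' ≫ η ∧ η ≫ δ = β' ≫ ε ∧ IsPullbackMorphism F β' ∧
      pull Φ (Base F γ) (invDiv F η hη.1.2) = invDiv F ε hε.1.2 := by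
  have hP := hF.isPreFrobenioid
  have hεcoa : IsCoAngularPreStep F ε := ⟨isCoAngular_of_isOfIsotropicType F hiso ε, hε.1⟩
  -- the lower square (Prop. 1.11 (v))
  obtain ⟨W, η, β', hη, hβ', hsq⟩ := exists_preStep_pullback_square hF hiso δ hδ ε hεcoa
  have hxη : invDiv F η hη.2.2 = pull Φ (Base F δ) (invDiv F ε hε.1.2) :=
    invDiv_eq_pull_of_pullback_square hF hη.2 hδ hβ' hε.1 hsq
  have hγη : pull Φ (Base F γ) (invDiv F η hη.2.2) = invDiv F ε hε.1.2 := by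
    rw [hxη, ← pull_comp, ← base_comp, hfac]
    exact DFunLike.congr_fun hα _
  -- `η` is a primary pre-step
  haveI : IsIso (Base F γ) := hγ
  have hηprim : IsPrimaryPreStep F η := isPrimaryPreStep_of_isPrimary_invDiv hη.2
    ((isPrimary_pull_iff (Base F γ) _).mp (by rw [hγη]; exact isPrimary_invDiv hε))
  -- the upper square: `ε ≫ γ = γ₁ ≫ s` with `s` a co-angular pre-step through which `η` divides
  have hεγ : IsBaseIso F (ε ≫ γ) := IsBaseIso.comp F hε.1.2 hγ
  obtain ⟨X₁, γ₁, s, hfac₁, hγ₁, hs⟩ := exists_frobeniusType_comp_coAngularPreStep hF hiso (ε ≫ γ) hεγ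
  have hdvd : invDiv F η hη.2.2 ∣ invDiv F s hs.2.2 := by
    haveI : IsIso (Base F (γ₁ ≫ s)) := by rw [hfac₁]; exact hεγ
    obtain ⟨e, he⟩ := exists_mulEquiv_pull (Φ := Φ) (Base F (γ₁ ≫ s))
    have hL : pull Φ (Base F (γ₁ ≫ s)) (invDiv F η hη.2.2) = Div F ε := by
      rw [show Base F (γ₁ ≫ s) = Base F ε ≫ Base F γ by rw [hfac₁, base_comp], pull_comp, hγη, pull_invDiv]
    have hR : pull Φ (Base F (γ₁ ≫ s)) (invDiv F s hs.2.2) = Div F (ε ≫ γ) := by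
      rw [base_comp, pull_comp, pull_invDiv, ← hfac₁, div_comp, show Div F γ₁ = 1 from hγ₁.1.2, one_pow,
        mul_one]
    have h' : e (invDiv F η hη.2.2) ∣ e (invDiv F s hs.2.2) := by
      rw [he, he, hL, hR, div_comp]
      exact dvd_mul_of_dvd_right (dvd_pow_self _ (PNat.ne_zero _)) _
    simpa using map_dvd e.symm.toMonoidHom h'
  obtain ⟨g, -, hgs⟩ := hF.iii_d_over_full s η hs hη hdvd
  refine ⟨W, γ₁ ≫ g, η, β', hηprim, ?_, hsq, hβ', hγη⟩
  rw [Category.assoc, hgs, hfac₁]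

end PreFrobenioid

namespace FrdI.T42

open PreFrobenioid

universe w v v' u u'

/-- **[FrdI] Thm. 4.2 (i), the characterisation of Div-identity endomorphisms — row T42-L11 AS TYPED**
(`DivIdentityEndoCharacterisation`, FACT-LIST row F-2654): in a Frobenioid of perfect and isotropic type with
`Φ` perf-factorial and non-dilating, an endomorphism `α` of a non-group-like `A` is a Div-identity
endomorphism iff it factors as `α = γ ≫ β` (base-isomorphism, then pull-back morphism) admitting, for every
primary step `A′ → A`, the commutative diagram of the statement. [cite: MochizukiFrdI2008, Thm. 4.2 (i) p.81] -/
theorem divIdentityEndoCharacterisation_holds :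
    Literature.AlgebraicGeometry.Frobenioids.FrdI.T42.DivIdentityEndoCharacterisation.{w, v, v', u, u'} := by
  intro D _ Φ C _ F hF _ hiso _ hnd A _ α
  constructor
  · intro hα
    -- `α = (γ₀ ≫ β₀) ≫ δ`: Frobenius type, pre-step, pull-back (Def. 1.3 (iv)(a))
    obtain ⟨X, B, γ₀, β₀, δ, hfac, hγ₀, hβ₀, hδ⟩ := hF.iv_a_exists α
    have hγ : IsBaseIso F (γ₀ ≫ β₀) := IsBaseIso.comp F hγ₀.2 hβ₀.2
    have hfac' : (γ₀ ≫ β₀) ≫ δ = α := by rw [Category.assoc]; exact hfac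
    refine ⟨B, γ₀ ≫ β₀, δ, hfac', hγ, hδ, fun A' ε _ hε => ?_⟩
    obtain ⟨W, γ', η, β', hη, hup, hlow, hβ', hγη⟩ :=
      exists_diagram_of_isDivIdentity hF hiso hα hfac' hγ hδ ε hε
    refine ⟨W, A', γ', η, β', ε, hup, hlow, hη.isStep hF.isPreFrobenioid, hη, hε.isStep hF.isPreFrobenioid,
      hε, hβ', fun _ _ => ?_, fun _ _ => ?_⟩
    · refine ⟨_, mem_carrier_mk_of_isPrimary (isPrimary_invDiv hε), ?_⟩
      rw [show pull Φ (Base F (γ₀ ≫ β₀)) (invDiv F η _) = invDiv F ε hε.1.2 from hγη]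
      exact mem_carrier_mk_of_isPrimary _
    · exact ⟨_, mem_carrier_mk_of_isPrimary (isPrimary_invDiv hε), mem_carrier_mk_of_isPrimary _⟩
  · rintro ⟨B, γ, β, hfac, -, hβ, hdiag⟩
    exact isDivIdentity_of_diagrams hF hnd α γ β hfac hβ fun A' ε hs hε => by
      obtain ⟨B', A'', γ', η, β', ε'', -, hlow, -, hη, -, hε'', hβ', hP1, hP2⟩ := hdiag ε hs hε
      exact ⟨B', A'', γ', η, β', ε'', hlow, hη, hε'', hβ', hP1, hP2⟩

end FrdI.T42

end Literature.AlgebraicGeometry.Frobenioids
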